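import Summits.ResolutionOfSingularities.ResolutionOfSingularities.Theorems.FrobeniusLadderFRationalResolutionEtaleLocalResolution
import HarnessLib

/-!
# Crux `FrobeniusLadder.FRationalResolution` (stmt-ResolutionOfSingularities-15317), line `redirect`,
# stub `stub_diagonalizableQuotientResolution` — **under `hq` VERBATIM, `X` is ÉTALE-LOCALLY
# KATO-LOG-REGULAR for one fs chart** (every field, tame or wild): the structural form of
# `…EtaleLocalResolution`, i.e. the exact input of Kato 1994 (10.4) on each étale piece

`…EtaleLocalResolution` records only `Scheme.HasResolution` of the étale pieces. For the remaining
GLUING problem (functorial resolution / destackification) the useful datum is the LOG STRUCTURE: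
here we keep it. Ring level (`…WildLogRegularNhd.exists_nhd_isLogRegularAt_of_units` + chart
normalisation `…FixedPointResolvableNhd.exists_normalized_chart_forall` + Kato's (2.1) along the
localization `S₀ → (S₀)_g`, `…FixedPointResolvableNhd.isLogRegularAt_of_isLocalization`): the
affine neighbourhood `Spec (S₀)_g` carries ONE chart `χ : P' → S₀ → (S₀)_g` by a finitely
generated submonoid `P' ⊆ ℤᴺ`, saturated in `ℤᴺ` and spanning it, log regular at EVERY prime of
`(S₀)_g` (any model of the localization) — the hypotheses of `Kato1994_logRegular_hasResolution`
verbatim. Scheme level as in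
`…EtaleLocalResolution` (localize the chart ring at `t`, `…AwayUnits`, `…FixedChart`).

* `exists_fsChart_forall_isLogRegularAt_away_of_units` — ring level with global units;
* `exists_chart_fsChart_away` — ring level at any point of `Spec S₀` (after `S ↦ S_t`);
* **`exists_etale_nhd_logRegular_of_hq`** — every `x ∈ X` has an étale neighbourhood
  `Spec T → X`, `T` Noetherian with an fs spanning chart log regular at all primes.

Honest label: structural ceiling of the log-regular line (étale-locally toroidal, all fields); no
stub closed (gluing remains). No definitions, no named facts, no sorry.
[cite: Kato1994, (1.5), Def. (2.1), Prop. (7.1)] [folklore; cite: SGA3, Exp. VIII §4–5]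
-/

noncomputable section

-- single-problem summit: the doubled namespace component is forced
set_option linter.dupNamespace false

open CategoryTheory AlgebraicGeometry
open Literature.RingTheory.GradedAlgebra
open Literature.AlgebraicGeometry.Resolution
open Literature.AlgebraicGeometry.Resolution.DiagonalizableQuotient

namespace Summit.ResolutionOfSingularities.ResolutionOfSingularities.Theorems.FRationalResolution.EtaleLocalLogRegular

universe u w

section Ring

variable {k : Type u} [Field k] {A : Type w} [DecidableEq A] [AddCommGroup A] {S : Type u}
  [CommRing S] [Algebra k S] (𝒮 : A → Submodule k S) [GradedAlgebra 𝒮]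

/-- **Ring level, global units: `Spec (S₀)_g` is log regular EVERYWHERE for one fs spanning
chart.** `S` regular of finite type over a field, graded by a finite abelian group `A`; `𝔔` any
prime whose unit degrees carry global homogeneous units. Then for some `g ∈ S₀ ∖ 𝔔` the ring
`S₀` carries a chart `χ : P' → S₀`, `P' ⊆ ℤᴺ` finitely generated, saturated and spanning, log
regular at every prime of (any model of) `(S₀)_g`. [cite: Kato1994, (1.5), Def. (2.1), Prop. (7.1)] -/
theorem exists_fsChart_forall_isLogRegularAt_away_of_units [IsRegularRing S]
    [Algebra.FiniteType k S] [Finite A] (𝔔 : Ideal S) [𝔔.IsPrime] (B : AddSubgroup A)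
    (hB : ∀ a : A, a ∈ B ↔ ∃ s ∈ 𝒮 a, s ∉ 𝔔) (hunits : ∀ b ∈ B, ∃ u ∈ 𝒮 b, IsUnit u) :
    ∃ g : 𝒮 0, (g : S) ∉ 𝔔 ∧ ∃ (N : ℕ) (P' : AddSubmonoid (Fin N → ℤ))
      (χ : Multiplicative P' →* 𝒮 0),
      P'.FG ∧ (∀ (v : Fin N → ℤ) (m : ℕ), 0 < m → m • v ∈ P' → v ∈ P') ∧
        Submodule.span ℤ (P' : Set (Fin N → ℤ)) = ⊤ ∧
        ∀ (L : Type u) [CommRing L] [Algebra (𝒮 0) L] [IsLocalization.Away g L]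
          (𝔓 : Ideal L) [𝔓.IsPrime],
          LogChart.IsLogRegularAt P' ((algebraMap (𝒮 0) L).toMonoidHom.comp χ) 𝔓 := by
  have hA : AddMonoid.IsTorsion A := fun a => isOfFinAddOrder_of_finite a
  obtain ⟨N, y, c, -, ψ, -, g, hg, hreg⟩ :=
    WildLogRegularNhd.exists_nhd_isLogRegularAt_of_units 𝒮 𝔔 B hB hunits
  have hc : ∀ l, IsOfFinAddOrder (c l) := fun l => hA (c l)
  obtain ⟨P', e, hfg, hsat, hspan, hiff⟩ :=
    FixedPointResolvableNhd.exists_normalized_chart_forall c hc ψ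
  refine ⟨g, hg, N, P', ψ.comp (AddMonoidHom.toMultiplicative e.toAddMonoidHom), hfg,
    fun v m hm hmv => (hsat hmv).resolve_left (Nat.pos_iff_ne_zero.mp hm), hspan,
    fun L _ _ _ 𝔓 _ => ?_⟩
  refine FixedPointResolvableNhd.isLogRegularAt_of_isLocalization (Submonoid.powers g) P' _ 𝔓 ?_
  have hg𝔓 : g ∉ 𝔓.comap (algebraMap (𝒮 0) L) := fun h =>
    ‹𝔓.IsPrime›.ne_top (Ideal.eq_top_of_isUnit_mem _ (Ideal.mem_comap.mp h)
      (IsLocalization.Away.algebraMap_isUnit g))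
  exact (hiff (𝔓.comap _)).mpr (hreg _ hg𝔓)

/-- **Ring level at any point of `Spec S₀`**: after the étale localization `S₀ → (S_t)_0`
(`…FixedChart.etale_locPieceZeroHom`) there are a prime `w` over the given point and
`g ∉ w` such that an fs spanning chart `P' → (S_t)_0` is log regular at every prime of `((S_t)_0)_g`.
[cite: Kato1994, (1.5), Def. (2.1), Prop. (7.1)] [folklore; cite: SGA3, Exp. VIII §4–5] -/
theorem exists_chart_fsChart_away (k : Type) [Field k] (A : Type) [AddCommGroup A]
    [Finite A] [DecidableEq A] (S : Type) [CommRing S] [Algebra k S] (𝒮 : A → Submodule k S)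
    [GradedAlgebra 𝒮] [Algebra.FiniteType k S] [IsRegularRing S] (v : Spec (.of (𝒮 0))) :
    ∃ (R : Type) (_ : CommRing R) (_ : IsNoetherianRing R) (j : 𝒮 0 →+* R), j.Etale ∧
      ∃ w : PrimeSpectrum R, w.asIdeal.comap j = v.asIdeal ∧
        ∃ g : R, g ∉ w.asIdeal ∧ ∃ (N : ℕ) (P' : AddSubmonoid (Fin N → ℤ))
          (χ : Multiplicative P' →* R),
          P'.FG ∧ (∀ (v : Fin N → ℤ) (m : ℕ), 0 < m → m • v ∈ P' → v ∈ P') ∧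
            Submodule.span ℤ (P' : Set (Fin N → ℤ)) = ⊤ ∧
            ∀ (L : Type) [CommRing L] [Algebra R L] [IsLocalization.Away g L]
              (𝔓 : Ideal L) [𝔓.IsPrime],
              LogChart.IsLogRegularAt P' ((algebraMap R L).toMonoidHom.comp χ) 𝔓 := by
  -- adapted from `…EtaleLocalResolution.exists_chart_hasResolution_away`
  classical
  have hA : AddMonoid.IsTorsion A := fun a => isOfFinAddOrder_of_finite a
  obtain ⟨wS, hwS⟩ := comap_algebraMap_gradeZero_surjective 𝒮 hA v
  let 𝔔 : Ideal S := wS.asIdeal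
  haveI h𝔔prime : 𝔔.IsPrime := wS.isPrime
  have h𝔔v : 𝔔.comap (algebraMap (𝒮 0) S) = v.asIdeal := by
    have h := congrArg PrimeSpectrum.asIdeal hwS
    rwa [PrimeSpectrum.comap_asIdeal] at h
  obtain ⟨B, hB, -⟩ := StabilizerSubgroup.exists_unitDegrees_addSubgroup 𝒮 hA 𝔔
  obtain ⟨t, ht0, -, hT, hloc⟩ := AwayUnits.exists_away_units (k := k) 𝒮 𝔔 B hB
  let L : Type := Localization.Away t
  obtain ⟨hprime, hcomap, hBL, -, hunitL⟩ := hloc L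
  let ℒ : A → Submodule k L := locPiece 𝒮 (Submonoid.powers t) hT L
  letI instℒ : GradedAlgebra ℒ := (nonempty_gradedAlgebra_locPiece 𝒮 _ hT L).some
  set 𝔔L : Ideal L := 𝔔.map (algebraMap S L) with h𝔔L
  haveI : 𝔔L.IsPrime := hprime
  haveI : Algebra.FiniteType k L := by
    show Algebra.FiniteType k (Localization (Submonoid.powers t))
    infer_instance
  haveI : IsRegularRing L := isRegularRing_localization (Submonoid.powers t)
  obtain ⟨g, hg, hchart⟩ :=
    exists_fsChart_forall_isLogRegularAt_away_of_units ℒ 𝔔L B hBL hunitL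
  let j : 𝒮 0 →+* ℒ 0 := locPieceZeroHom 𝒮 (Submonoid.powers t) hT L
  have hjet : j.Etale := FixedChart.etale_locPieceZeroHom 𝒮 ht0 hT L
  let w : PrimeSpectrum (ℒ 0) := ⟨𝔔L.comap (algebraMap (ℒ 0) L), inferInstance⟩
  have hw : w.asIdeal.comap j = v.asIdeal := by
    show (𝔔L.comap (algebraMap (ℒ 0) L)).comap j = v.asIdeal
    rw [Ideal.comap_comap, ← h𝔔v, ← hcomap, Ideal.comap_comap]
    congr 1
  haveI : IsNoetherianRing (ℒ 0) := isNoetherianRing_gradeZero ℒ hA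
  refine ⟨ℒ 0, inferInstance, inferInstance, j, hjet, w, hw, g, ?_, hchart⟩
  show g ∉ 𝔔L.comap (algebraMap (ℒ 0) L)
  rw [Ideal.mem_comap]
  exact hg

end Ring

/-- **Under `hq` verbatim, `X` is étale-locally log regular for one fs chart (every field, tame or
wild).** Every `x ∈ X` has an étale neighbourhood `ψ : Spec T → X`, `x ∈ ψ(Spec T)`, with `T`
Noetherian carrying a chart `χ : P' → T` by a finitely generated submonoid `P' ⊆ ℤᴺ` saturated in
`ℤᴺ` and spanning it, Kato-log-regular at every prime of `T` — the hypotheses of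
`Kato1994_logRegular_hasResolution` for `Spec T`. [cite: Kato1994, (1.5), Def. (2.1), Prop. (7.1)]
[folklore; cite: SGA1, Exp. I Prop. 7.6; SGA3, Exp. VIII §4–5] -/
theorem exists_etale_nhd_logRegular_of_hq (k : Type) [Field k] (X : Scheme.{0})
    (g : X ⟶ Spec (.of k))
    (hq : ∀ x : X, ∃ (A : Type) (_ : AddCommGroup A) (_ : Finite A) (_ : DecidableEq A)
        (S : Type) (_ : CommRing S) (_ : Algebra k S) (𝒮 : A → Submodule k S)
        (_ : GradedAlgebra 𝒮), Algebra.FiniteType k S ∧ IsRegularRing S ∧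
        ∃ φ : Spec (.of (𝒮 0)) ⟶ X, Etale φ ∧ x ∈ Set.range φ ∧
          φ ≫ g = Spec.map (CommRingCat.ofHom (algebraMap k (𝒮 0))))
    (x : X) :
    ∃ (T : Type) (_ : CommRing T) (_ : IsNoetherianRing T) (ψ : Spec (.of T) ⟶ X),
      Etale ψ ∧ x ∈ Set.range ψ ∧ ∃ (N : ℕ) (P' : AddSubmonoid (Fin N → ℤ))
        (χ : Multiplicative P' →* T),
        P'.FG ∧ (∀ (v : Fin N → ℤ) (m : ℕ), 0 < m → m • v ∈ P' → v ∈ P') ∧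
          Submodule.span ℤ (P' : Set (Fin N → ℤ)) = ⊤ ∧
          ∀ (𝔓 : Ideal T) [𝔓.IsPrime], LogChart.IsLogRegularAt (A := T) P' χ 𝔓 := by
  classical
  obtain ⟨A, _, _, _, S, _, _, 𝒮, _, hft, hreg, φ, hφ, ⟨v, hv⟩, -⟩ := hq x
  haveI := hft
  haveI := hreg
  haveI := hφ
  obtain ⟨R, _, _, j, hjet, w, hw, g', hg', hchart⟩ := exists_chart_fsChart_away k A S 𝒮 v
  haveI : Etale (Spec.map (CommRingCat.ofHom j)) :=
    (HasRingHomProperty.Spec_iff (P := @Etale)).mpr hjet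
  let φ' : Spec (.of R) ⟶ X := Spec.map (CommRingCat.ofHom j) ≫ φ
  have hw' : Spec.map (CommRingCat.ofHom j) w = v := by
    apply PrimeSpectrum.ext
    rw [Spec.map_apply, PrimeSpectrum.comap_asIdeal]
    exact hw
  have hφ'w : φ' w = x := by
    show φ (Spec.map (CommRingCat.ofHom j) w) = x
    rw [hw', hv]
  obtain ⟨N, P', χ, hfg, hsat, hspan, hreg⟩ := hchart
  haveI : IsNoetherianRing (Localization.Away g') :=
    IsLocalization.isNoetherianRing (Submonoid.powers g') _ inferInstance
  refine ⟨Localization.Away g', inferInstance, inferInstance,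
    Spec.map (CommRingCat.ofHom (algebraMap R (Localization.Away g'))) ≫ φ', inferInstance, ?_,
    N, P', (algebraMap R (Localization.Away g')).toMonoidHom.comp χ, hfg, hsat, hspan,
    fun 𝔓 _ => hreg (Localization.Away g') 𝔓⟩
  have hvD : w ∈ (Spec.map (CommRingCat.ofHom (algebraMap R (Localization.Away g')))).opensRange := by
    rw [Scheme.Hom.opensRange_localizationAway (R := CommRingCat.of R) g']
    exact hg'
  obtain ⟨u, hu⟩ := Scheme.Hom.mem_opensRange.mp hvD
  exact ⟨u, by rw [Scheme.Hom.comp_apply, hu, hφ'w]⟩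

end Summit.ResolutionOfSingularities.ResolutionOfSingularities.Theorems.FRationalResolution.EtaleLocalLogRegular

end
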